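import Summits.AtomisticToContinuum.HydrodynamicLimit.Theses.StiffCollisionalRelaxation
import Literature.MathematicalPhysics.KineticTheory.HardSphereEulerProofs
import HarnessLib

/-!
# The cold-jam stub is no stronger than the level-`1` packing ceiling (stub `coldJam`, reductions)

Supporting file of the line `Sketch` (card `adiabat-pricing-of-the-ceiling`) for the crux
`AprioriBounds` (stmt-AtomisticToContinuum-14827).  The registered stub `stub_coldJam` of the lead's
skeleton (`Cruxes/AprioriBounds/Lines/Sketch.lean`) asks, under the crux's own prefix (profiles,
`σ < σ₀`, classical hard-sphere Euler solution on `[0, T)` tied to the local Gibbs laws at `t = 0`,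
pre-shock `t < T`, dilute chamber `2ρσ³ < η₁`, admissible kernel family at scale `(N+1)^{-γ}`,
`γ ≤ 1/15`), that for SOME room constant `D > 0` chosen before `η₁`, with probability `→ 1` no
mesoscopic block along the flow is JAMMED (`ρ̄σ³ > 1`) AND COLD (its hard-sphere adiabat, in cubed and
cross-multiplied form, more than `-½ log D` below EVERY initial adiabat `s(ρ(0,y), θ(0,y))`).

This file records, kernel-checked, the two cheap TRUE implications about that stub:

* `coldJam_of_halfCeiling`: the stub follows (with `D = 1`, indeed with any `D`) from the CEILING HALF
  of the crux's component (ii) along the flow, `P_N{∃ s ≤ t, ∃ x, ρ̄_N(s,x)σ³ > 1} → 0`, stated under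
  the identical prefix and binder order — the event `{jam ∧ cold}` is contained in `{jam}`
  (`measure_mono` and a squeeze in `ℝ≥0∞`);
* `coldJam_of_aprioriBounds`: in particular the stub follows from the crux decl
  `StiffCollisionalRelaxation.AprioriBounds` itself (`{jam} ⊆ {floor-breach ∨ jam}`), i.e. the reshape
  r2 of the skeleton does not ask MORE than the crux (consistency certificate for the lead).

What is deliberately NOT here: no dynamical input.  None of the tree's local second laws implies the
stub under the prefix: `JParityClosure.LocalSecondLaw` (stmt-13081) and its copies in
`CollisionMeasureChaos`, `InformationPercolation(Engine)`, `JOddEnslaving`, and the clamped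
`LimitCollisionMeasure.LocalSecondLaw` (stmt-13352) are WEAK-FORM (space–time integrated against test
functions) inequalities for TENT-mollified fields at a FIXED radius `r`, with `r → 0` only AFTER
`N → ∞`; a fixed-radius integrated statement does not see a block of radius `(N+1)^{-γ}` (volume
`O((N+1)^{-3γ})`), let alone pointwise in `(s, x)`.  `StiffCollisionalRelaxation.SecondLawInProbability`
(stmt-9521) does use the `(N+1)^{-γ}` kernels but is a GLOBAL (`x`-integrated) Clausius inequality,
which a single cold block of volume `O((N+1)^{-3γ})` perturbs by `o(1)`.  The missing input is a
mesoscopic packing bound `ρ̄σ³ ≤ 1` along the flow before `T` (or a pointwise block minimum-entropy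
principle at scale `(N+1)^{-γ}`), which is the crux's own dynamical content.

No new definitions, no named facts; axioms `propext`, `Classical.choice`, `Quot.sound`.
-/

noncomputable section

open MeasureTheory Filter Set Topology
open scoped ENNReal

namespace Summit.AtomisticToContinuum.HydrodynamicLimit.Theorems.AdiabatCeiling

open Literature.MathematicalPhysics.KineticTheory Literature.Analysis.FluidPDE

/-- REDUCTION `coldJam ⇐ half-ceiling`.  If, under the crux prefix (profiles, `σ < σ₀`, classical
hs-Euler solution tied to the local Gibbs laws at `t = 0`, `0 < t < T`, chamber `2ρσ³ < η₁`,
admissible kernel family, `γ ≤ 1/15`), the level-`1` packing ceiling holds along the flow in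
probability, `P_N{∃ s ∈ [0,t], ∃ x, 1 < ρ̄_N(s,x)·σ³} → 0`, then the registered stub `stub_coldJam`
holds VERBATIM, with the same `σ₀`, `η₁` and the room constant `D := 1`: the cold-jam event is
contained in the jam event (`measure_mono`, squeeze in `ℝ≥0∞`).  Pure bookkeeping; the hypothesis is
the ceiling half of component (ii) of `StiffCollisionalRelaxation.AprioriBounds`. -/
theorem coldJam_of_halfCeiling :
    (∀ (a₀ θ₀ : T3 → ℝ) (u₀ : T3 → V3), Continuous a₀ → Continuous θ₀ → Continuous u₀ →
      (∀ x, 0 < a₀ x) → (∀ x, 0 < θ₀ x) →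
      ∃ σ₀ : ℝ, 0 < σ₀ ∧ ∃ η₁ : ℝ, 0 < η₁ ∧ ∀ σ : ℝ, 0 < σ → σ < σ₀ →
        ∀ (T : ℝ) (ρ θ : ℝ → T3 → ℝ) (u : ℝ → T3 → V3), IsHardSphereEulerSolution σ T ρ u θ →
        ∀ Φ : (N : ℕ) → HardSphereFlow (Torus.geometry (Fin 3)) (hsDiameter σ N) (N + 1),
          TendstoHydroFieldsAt (fun N => localGibbsLaw σ a₀ u₀ θ₀ N (Φ N)) Φ ρ u θ 0 →
          ∀ t : ℝ, 0 < t → t < T → (∀ s ∈ Icc 0 t, ∀ x, 2 * ρ s x * σ ^ 3 < η₁) →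
            ∀ (γ C : ℝ) (φ : ℕ → T3 → ℝ), 0 < γ → γ ≤ 1 / 15 →
              ((∀ N, Literature.Analysis.FunctionSpaces.Torus.IsSmooth (φ N)) ∧ (∀ N y, 0 ≤ φ N y) ∧
                (∀ N, ∫ y, φ N y = 1) ∧
                (∀ (N : ℕ) y, ((N : ℝ) + 1) ^ (-γ) ≤ Torus.euclidDist y 0 → φ N y = 0) ∧
                (∀ (N : ℕ) y, φ N y ≤ C * ((N : ℝ) + 1) ^ (3 * γ)) ∧
                (∀ (N : ℕ) y, ‖Literature.Analysis.FunctionSpaces.Torus.gradient (φ N) y‖ ≤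
                  C * ((N : ℝ) + 1) ^ (4 * γ))) →
              Tendsto (fun N : ℕ => localGibbsLaw σ a₀ u₀ θ₀ N (Φ N)
                {z | ∃ s ∈ Icc 0 t, ∃ x : T3,
                  1 < empiricalDensityField ((Φ N).flow s z) (fun y => φ N (y - x)) * σ ^ 3})
                atTop (𝓝 0)) →
    ∀ (a₀ θ₀ : T3 → ℝ) (u₀ : T3 → V3), Continuous a₀ → Continuous θ₀ → Continuous u₀ →
      (∀ x, 0 < a₀ x) → (∀ x, 0 < θ₀ x) →
      ∃ σ₀ : ℝ, 0 < σ₀ ∧ ∃ D : ℝ, 0 < D ∧ ∃ η₁ : ℝ, 0 < η₁ ∧ ∀ σ : ℝ, 0 < σ → σ < σ₀ →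
        ∀ (T : ℝ) (ρ θ : ℝ → T3 → ℝ) (u : ℝ → T3 → V3), IsHardSphereEulerSolution σ T ρ u θ →
        ∀ Φ : (N : ℕ) → HardSphereFlow (Torus.geometry (Fin 3)) (hsDiameter σ N) (N + 1),
          TendstoHydroFieldsAt (fun N => localGibbsLaw σ a₀ u₀ θ₀ N (Φ N)) Φ ρ u θ 0 →
          ∀ t : ℝ, 0 < t → t < T → (∀ s ∈ Icc 0 t, ∀ x, 2 * ρ s x * σ ^ 3 < η₁) →
            ∀ (γ C : ℝ) (φ : ℕ → T3 → ℝ), 0 < γ → γ ≤ 1 / 15 →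
              ((∀ N, Literature.Analysis.FunctionSpaces.Torus.IsSmooth (φ N)) ∧ (∀ N y, 0 ≤ φ N y) ∧
                (∀ N, ∫ y, φ N y = 1) ∧
                (∀ (N : ℕ) y, ((N : ℝ) + 1) ^ (-γ) ≤ Torus.euclidDist y 0 → φ N y = 0) ∧
                (∀ (N : ℕ) y, φ N y ≤ C * ((N : ℝ) + 1) ^ (3 * γ)) ∧
                (∀ (N : ℕ) y, ‖Literature.Analysis.FunctionSpaces.Torus.gradient (φ N) y‖ ≤
                  C * ((N : ℝ) + 1) ^ (4 * γ))) →
              Tendsto (fun N : ℕ => localGibbsLaw σ a₀ u₀ θ₀ N (Φ N)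
                {z | ∃ s ∈ Icc 0 t, ∃ x : T3,
                  1 < empiricalDensityField ((Φ N).flow s z) (fun y => φ N (y - x)) * σ ^ 3 ∧
                  ∀ y : T3,
                    (2 / 3 * (empiricalEnergyField ((Φ N).flow s z) (fun y => φ N (y - x)) /
                          empiricalDensityField ((Φ N).flow s z) (fun y => φ N (y - x)) -
                        ‖empiricalMomentumField ((Φ N).flow s z) (fun y => φ N (y - x))‖ ^ 2 /
                          (2 * empiricalDensityField ((Φ N).flow s z) (fun y => φ N (y - x)) ^ 2))) ^ 3 *
                      ρ 0 y ^ 2 <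
                    D * θ 0 y ^ 3 *
                      empiricalDensityField ((Φ N).flow s z) (fun y => φ N (y - x)) ^ 2 *
                      Real.exp (2 * (hsExcessFreeEnergy
                          (empiricalDensityField ((Φ N).flow s z) (fun y => φ N (y - x)) * σ ^ 3) -
                        hsExcessFreeEnergy (ρ 0 y * σ ^ 3)))}) atTop (𝓝 0) := by
  intro H a₀ θ₀ u₀ ha hθ hu ha0 hθ0
  obtain ⟨σ₀, hσ₀, η₁, hη₁, h⟩ := H a₀ θ₀ u₀ ha hθ hu ha0 hθ0
  refine ⟨σ₀, hσ₀, 1, one_pos, η₁, hη₁, ?_⟩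
  intro σ hσ hσlt T ρ θ u hsol Φ hLLN t ht htT hdil γ C φ hγ hγ' hadm
  have hceil := h σ hσ hσlt T ρ θ u hsol Φ hLLN t ht htT hdil γ C φ hγ hγ' hadm
  refine tendsto_of_tendsto_of_tendsto_of_le_of_le tendsto_const_nhds hceil (fun _ => bot_le)
    (fun N => measure_mono ?_)
  rintro z ⟨s, hs, x, hjam, -⟩
  exact ⟨s, hs, x, hjam⟩

/-- CONSISTENCY `coldJam ⇐ AprioriBounds`.  The registered stub `stub_coldJam` is implied by the crux
decl `StiffCollisionalRelaxation.AprioriBounds` it serves (with `D := 1`): component (ii) of the crux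
gives, for every admissible kernel family, `∃ c₁ > 0, P_N{∃ s ≤ t, ∃ x, ρ̄ < c₁ ∨ 1 < ρ̄σ³} → 0`, whose
event contains the jam event, which contains the cold-jam event (`coldJam_of_halfCeiling`).  So the
skeleton's reshape r2 asks no more of the dynamics than the crux itself. -/
theorem coldJam_of_aprioriBounds :
    Summit.AtomisticToContinuum.HydrodynamicLimit.Theses.StiffCollisionalRelaxation.AprioriBounds →
    ∀ (a₀ θ₀ : T3 → ℝ) (u₀ : T3 → V3), Continuous a₀ → Continuous θ₀ → Continuous u₀ →
      (∀ x, 0 < a₀ x) → (∀ x, 0 < θ₀ x) →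
      ∃ σ₀ : ℝ, 0 < σ₀ ∧ ∃ D : ℝ, 0 < D ∧ ∃ η₁ : ℝ, 0 < η₁ ∧ ∀ σ : ℝ, 0 < σ → σ < σ₀ →
        ∀ (T : ℝ) (ρ θ : ℝ → T3 → ℝ) (u : ℝ → T3 → V3), IsHardSphereEulerSolution σ T ρ u θ →
        ∀ Φ : (N : ℕ) → HardSphereFlow (Torus.geometry (Fin 3)) (hsDiameter σ N) (N + 1),
          TendstoHydroFieldsAt (fun N => localGibbsLaw σ a₀ u₀ θ₀ N (Φ N)) Φ ρ u θ 0 →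
          ∀ t : ℝ, 0 < t → t < T → (∀ s ∈ Icc 0 t, ∀ x, 2 * ρ s x * σ ^ 3 < η₁) →
            ∀ (γ C : ℝ) (φ : ℕ → T3 → ℝ), 0 < γ → γ ≤ 1 / 15 →
              ((∀ N, Literature.Analysis.FunctionSpaces.Torus.IsSmooth (φ N)) ∧ (∀ N y, 0 ≤ φ N y) ∧
                (∀ N, ∫ y, φ N y = 1) ∧
                (∀ (N : ℕ) y, ((N : ℝ) + 1) ^ (-γ) ≤ Torus.euclidDist y 0 → φ N y = 0) ∧
                (∀ (N : ℕ) y, φ N y ≤ C * ((N : ℝ) + 1) ^ (3 * γ)) ∧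
                (∀ (N : ℕ) y, ‖Literature.Analysis.FunctionSpaces.Torus.gradient (φ N) y‖ ≤
                  C * ((N : ℝ) + 1) ^ (4 * γ))) →
              Tendsto (fun N : ℕ => localGibbsLaw σ a₀ u₀ θ₀ N (Φ N)
                {z | ∃ s ∈ Icc 0 t, ∃ x : T3,
                  1 < empiricalDensityField ((Φ N).flow s z) (fun y => φ N (y - x)) * σ ^ 3 ∧
                  ∀ y : T3,
                    (2 / 3 * (empiricalEnergyField ((Φ N).flow s z) (fun y => φ N (y - x)) /
                          empiricalDensityField ((Φ N).flow s z) (fun y => φ N (y - x)) -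
                        ‖empiricalMomentumField ((Φ N).flow s z) (fun y => φ N (y - x))‖ ^ 2 /
                          (2 * empiricalDensityField ((Φ N).flow s z) (fun y => φ N (y - x)) ^ 2))) ^ 3 *
                      ρ 0 y ^ 2 <
                    D * θ 0 y ^ 3 *
                      empiricalDensityField ((Φ N).flow s z) (fun y => φ N (y - x)) ^ 2 *
                      Real.exp (2 * (hsExcessFreeEnergy
                          (empiricalDensityField ((Φ N).flow s z) (fun y => φ N (y - x)) * σ ^ 3) -
                        hsExcessFreeEnergy (ρ 0 y * σ ^ 3)))}) atTop (𝓝 0) := by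
  intro hAB
  refine coldJam_of_halfCeiling ?_
  intro a₀ θ₀ u₀ ha hθ hu ha0 hθ0
  obtain ⟨σ₀, hσ₀, η₁, hη₁, h⟩ := hAB a₀ θ₀ u₀ ha hθ hu ha0 hθ0
  refine ⟨σ₀, hσ₀, η₁, hη₁, ?_⟩
  intro σ hσ hσlt T ρ θ u hsol Φ hLLN t ht htT hdil γ C φ hγ hγ' hadm
  obtain ⟨c₁, -, hii⟩ := (h σ hσ hσlt T ρ θ u hsol Φ hLLN t ht htT hdil).2 γ C φ hγ hγ' hadm
  refine tendsto_of_tendsto_of_tendsto_of_le_of_le tendsto_const_nhds hii (fun _ => bot_le)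
    (fun N => measure_mono ?_)
  rintro z ⟨s, hs, x, hjam⟩
  exact ⟨s, hs, x, Or.inr hjam⟩

end Summit.AtomisticToContinuum.HydrodynamicLimit.Theorems.AdiabatCeiling

end
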